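import Mathlib
import HarnessLib
import Literature.Probability.LatticeModels.LatticeBootstrapFeasible
import Summits.CriticalPhenomena.Ising3DConformalLimit.Theses.LatticeSDPCertificates
import Summits.CriticalPhenomena.Ising3DConformalLimit.Theorems.LatticeSDPCertificatesCertifiedWindowOneStep
import Summits.CriticalPhenomena.Ising3DConformalLimit.Theorems.LatticeSDPCertificatesCertifiedWindowHeatBathRows
import Summits.CriticalPhenomena.Ising3DConformalLimit.Theorems.LatticeSDPCertificatesCertifiedWindowMomentPositivity

/-!
# Line `kato-comparison` for crux `CertifiedWindow` (stmt-CriticalPhenomena-5504), route `LatticeSDPCertificates`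
# (crux-strategist s1, `--alt` to the registered line `Lines/birth.lean` rev 5b; the crux decl and signature are the route's)

Crux (`CertifiedWindow`, CW): an `R`-UNIFORM certificate — for all window constants `cw, Cw > 0` there are
`ε, c > 0`, `k ≥ 1` such that for every `R` and every probability boundary law `ν`, if the level-`kR`
Gibbs-inside mixture functional `E = boundaryLawFunctional 3 (kR) β_c ν` passes the lattice-bootstrap rows
`LatticeBootstrapFeasible (kR) cw Cw E`, then WINDOW holds for `E` up to scale `R`:
`c (n/m)^{-(3/2-ε)} E{0, m e₀} ≤ E{0, n e₀}` for `1 ≤ m ≤ n ≤ R`.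

## Why a second line
The registered line (birth, rev 5b) cuts CW into the BULK window (`stub_bulkWindow` = item `WindowBelowHalf`,
stmt-5507, verdict open-problem) ⊕ an `R`-uniform RATIO STABILITY of feasible functionals against the bulk
two-point function (`stub_boundaryScaleStabilityLP`).  Lead c0–c4 stalled on both halves: the second stub is a
critical boundary-influence RATE in `d = 3` (Harnack / RSW type, nothing in print), and it needs 5507 first
(`blocked-on: stmt-CriticalPhenomena-5507`).  This line compares `E` with NOTHING external: it never mentions
`criticalTwoPoint 3`, needs no boundary rate and does not consume 5507 as a black box.

## The line: NO POSITIVE EFFECTIVE MASS (Kato constant `< 3/4`) ⟹ WINDOW, by the discrete comparison principle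
For a function `u ≥ 0` on a cube write `Δu(x) = Σᵢ (u(x+eᵢ) + u(x−eᵢ)) − 6u(x)`.  If `Δu ≤ A·u/|x|₂²` on a
sup-norm annulus `{m ≤ ‖x‖∞ < M}` ("one-sided scale-invariant Kato bound", `A ≥ 0`), then the minimum
principle for `Δ − A/|x|₂²` with the single explicit subsolution `|x|₂^{-p} − M^{-p}`, `p(p−1) > A`, gives
`u(x) ≥ c₁ · (min_{‖y‖∞ = m−1} u) · (‖x‖∞/m)^{-p}` for `‖x‖∞ ≤ M/4` (STUB 2, pure lattice potential theory).
In `d = 3`, `Δ r^{-p} = p(p−1) r^{-p−2}`, so `p < 3/2 ⟺ p(p−1) < 3/4`: **a Kato constant `A < 3/4` is exactly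
an exponent `p < 3/2`, i.e. WINDOW** — the threshold `3/4` is dictated by the route's `3/2` (Källén–Lehmann /
`U₄`), not chosen.  Applied to `u = E{0,·}` of a row-feasible functional (Griffiths row: `u ≥ 0`; MMS rows: the
layer minimum at radius `m−1` dominates the axis value at `3(m−1)`, STUB 3), a Kato bound valid at RELATIVE DEPTH
(`r₀ ≤ ‖x‖∞ ≤ L/k₀`, constants depending on `cw, Cw` only — STUB 1, the open core) yields the one-step inequality
`κ E{0, n e₀} ≤ E{0, q n e₀}` with `κ = κ₀ q^{-p} > q^{-3/2}` for `q` large (STUB 4), and the landed criterion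
`certifiedWindow_of_oneStep` (= `stub_oneStepCriterion`, p145628) closes CW.

Why STUB 1 is a statement about the ROWS and not about the bulk: by the heat-bath (one-site DLR) rows, which every
boundary-law functional satisfies (`stub_heatBathRows`, landed) and which are LINEAR in `E`,
`ΔE{0,x} = E(σ₀ Ψ_x)`, `Ψ_x = S_x − 6 tanh(β_c S_x) = −0.0854·e₁ + 0.0713·e₃ − 0.0211·e₅` in the elementary
symmetric polynomials of the six neighbour spins of `x` (`β_c(3) = 0.22165`).  So STUB 1 is ONE LINEAR inequality
`E(σ₀Ψ_x) ≤ A |x|₂^{-2} E(σ₀σ_x)` on the convex feasible set — precisely the shape a finite-level LP/SDP dual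
certificate can prove scale by scale (the route's own technology), and its `x`-uniformity is the empirical content of
"no positive effective mass at any scale" (bulk Monte-Carlo, crux TwoPointDoubling job j026425: `ΔG·k²/G ≈ 0.05–0.13`
for `k ≤ 9`, expected limit `η(1+η) ≈ 0.038`; the line needs `< 0.75`).  In the Gaussian sibling (massless free
field, DLR-inside mixtures) STUB 1 holds with `A = 0` identically (`E{0,·}` is lattice-harmonic off `0` for EVERY
DLR-inside law) and STUBS 2–4 are the whole proof of the Gaussian CW: the transfer breaks exactly at the size of the
Ising defect `E(σ₀Ψ_x)` (clustered four- and six-point against two-point functions to relative precision `|x|⁻²`, margin 20×).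

Mechanism imported from crux `TwoPointDoubling` line `superharmonic-comparison` (strategist b1; idea card
`harnack-effective-mass`), which targets DOUBLING of the bulk profile with `∃ A`.  New here: (i) the quantitative
threshold `A < 3/4 ⟺ p < 3/2` (comparison then gives WINDOW, not just doubling — for the bulk this is also a new
sufficient condition for item 5507); (ii) the LP form: Kato for every row-feasible DLR-inside functional at relative
depth, which makes the certificate `R`-uniform with no comparison to the bulk state.

Stubs (4; sorries only inside `stub_*`; composition `CertifiedWindow_of` kernel-checked, concludes the route decl):
* `stub_feasibleKato` (OPEN — load-bearing, XL).
* `stub_annulusComparison` (PROVABLE NOW, L): discrete Taylor bound `Δ|x|₂^{-p} ≥ (p(p−1) − δ)|x|₂^{-p−2}` for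
  `‖x‖∞ ≥ r₁(δ)` + minimum principle for `Δ − V`, `V ≥ 0`, on a finite annulus. [folklore; Kuo–Trudinger-type]
* `stub_layerMinimum` (PROVABLE NOW, M): rows 2, 5, 6 (signed permutations, MMS axis/diagonal) give
  `E{0, 3m e₀} ≤ E{0, y}` for `‖y‖∞ = m` (row analogue of `criticalTwoPoint_axis_sandwich`). [MessagerMiracleSoleJSP1977]
* `stub_oneStepOfAnnulusBound` (PROVABLE NOW, M): scale bookkeeping uniform in `q` — large `n` via `m = n/3 + 1`,
  small `n` via the window rows — and the choice of `q` with `κ₀ q^{-p} > q^{-3/2}` (`p < 3/2`). [folklore]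

Disproof used: none on file (`ledger crux ls stmt-CriticalPhenomena-5504`: no Disproof.lean, no `_false_without_`,
no `Theorems/CertifiedWindow/Negative/`).  Honoured: barrier `AxisProfileAxiomaticsNoDoubling` (+ its extension
`NEGATIVE-profile-growth-no-window`): STUB 1 is not a profile fact — through the DLR rows it constrains 4- and 6-point
functions, which the lacunary / generalised-free-field witnesses do not possess (the sign-of-GFF impostor with
`E{0,x} ≍ |x|⁻²` has Kato constant `2 > 3/4` and is excluded only by the DLR rows: they are load-bearing).
Negatives index (`ledger negatives --problem CriticalPhenomena`, 11 entries): none concerns feasible functionals or CW.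
-/

noncomputable section

namespace Summit.CriticalPhenomena.Ising3DConformalLimit.Cruxes.CertifiedWindow.KatoComparison

open scoped BigOperators
open Literature.Probability.LatticeModels MeasureTheory
open Summit.CriticalPhenomena.Ising3DConformalLimit.Theses.LatticeSDPCertificates

/-! ## The four registered stubs (signatures over importable vocabulary only) -/

/-- **STUB 1 · `stub_feasibleKato` (OPEN — load-bearing, XL) — one-sided Kato bound with constant `< 3/4` for every
row-feasible DLR-inside functional, at relative depth.**  For all `cw, Cw > 0` there are `A < 3/4` and `r₀, k₀ ≥ 1`
such that every level-`L` functional `E` which is normalised, moment-positive, satisfies the heat-bath (DLR) rows at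
`β_c(3)` inside `Λ_L` and the rows `LatticeBootstrapFeasible L cw Cw E` obeys
`Σᵢ (E{0,x+eᵢ} + E{0,x−eᵢ}) − 6 E{0,x} ≤ A · E{0,x} / |x|₂²` for `r₀ ≤ ‖x‖∞`, `k₀‖x‖∞ ≤ L`.
By the DLR row at `x` the left side is `E(σ₀Ψ_x)`, `Ψ_x = S_x − 6 tanh(β_c S_x)`: a linear inequality on the feasible set.
Why plausible: bulk numerics `A ≈ 0.05–0.13 ≪ 3/4` (j026425); leading order cancels identically; boundary influence at
relative depth `1/k₀` perturbs the ratio by `O((k₀⁻¹)^θ)`.  Why it might fail: no correlation inequality is sharp beyond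
`O(1)` factors at clustered points; a feasible non-Gibbs mixture could bend at relative depth with Kato ratio in `[3/4, ∞)`
while keeping window-like ratios. [ChoSun2023 Def. 12; FriedliVelenik2017 Ch. 6 (DLR); AizenmanDuminilCopinAnnals2021 Rem. 5.10] -/
theorem stub_feasibleKato : ∀ cw Cw : ℝ, 0 < cw → 0 < Cw → ∃ A : ℝ, A < 3 / 4 ∧ ∃ r₀ k₀ : ℕ, 1 ≤ r₀ ∧ 1 ≤ k₀ ∧
    ∀ (L : ℕ) (E : Finset (Literature.Probability.LatticeModels.Site 3) → ℝ), E ∅ = 1 →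
      (∀ (D : Finset (Literature.Probability.LatticeModels.Site 3))
          (σ : Literature.Probability.LatticeModels.SpinConfig (Literature.Probability.LatticeModels.Site 3)),
        0 ≤ ∑ T ∈ D.powerset, Literature.Probability.LatticeModels.spinProduct T σ * E T) →
      (∀ x : Literature.Probability.LatticeModels.Site 3, x ∈ Literature.Probability.LatticeModels.box 3 L →
        ∀ (τ : Literature.Probability.LatticeModels.SpinConfig (Literature.Probability.LatticeModels.Site 3))
          (B : Finset (Literature.Probability.LatticeModels.Site 3)), x ∉ B →
          ∑ S ∈ ((Literature.Probability.LatticeModels.zdGraph 3).neighborFinset x).powerset,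
              Literature.Probability.LatticeModels.spinProduct S τ * E (insert x (symmDiff B S)) =
            Real.tanh (Literature.Probability.LatticeModels.criticalBeta 3 *
                ∑ y ∈ (Literature.Probability.LatticeModels.zdGraph 3).neighborFinset x,
                  Literature.Probability.LatticeModels.spinAt y τ) *
              ∑ S ∈ ((Literature.Probability.LatticeModels.zdGraph 3).neighborFinset x).powerset,
                Literature.Probability.LatticeModels.spinProduct S τ * E (symmDiff B S)) →
      Literature.Probability.LatticeModels.LatticeBootstrapFeasible L cw Cw E →
      ∀ x : Literature.Probability.LatticeModels.Site 3,
        r₀ ≤ Literature.Probability.LatticeModels.Site.supNorm x →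
        k₀ * Literature.Probability.LatticeModels.Site.supNorm x ≤ L →
        (∑ i : Fin 3, (E {0, x + Pi.single i 1} + E {0, x - Pi.single i 1})) - 6 * E {0, x} ≤
          A * E {0, x} / (∑ i : Fin 3, ((x i : ℝ)) ^ 2) := by
  sorry

/-- **STUB 2 · `stub_annulusComparison` (provable now, L) — the discrete comparison principle on a sup-norm annulus of
`ℤ³` for the Schrödinger operator `Δ − A/|x|₂²`, `0 ≤ A < 3/4`, with an exponent `p < 3/2`.**
There is `p ∈ (1, 3/2)` (any `p` with `A < p(p−1) < 3/4`), `r₁ ≥ 2`, `c₁ > 0` such that: if `u ≥ 0` on `{‖x‖∞ ≤ M}`,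
`u ≥ μ ≥ 0` on the layer `{‖x‖∞ = m−1}`, `r₁ ≤ m`, `4m ≤ M`, and `Δu ≤ A u/|x|₂²` on `{m ≤ ‖x‖∞ ≤ M−1}`, then
`u(x) ≥ c₁ μ (‖x‖∞/m)^{-p}` for `m ≤ ‖x‖∞ ≤ M/4`.  Proof route: discrete Taylor `Δ|x|₂^{-p} ≥ (p(p−1) − δ)|x|₂^{-p−2}`
for `‖x‖∞ ≥ r₁(δ)`; comparison function `μ (m−1)^p (|x|₂^{-p} − M^{-p})`; minimum principle for `Δ − V`, `V ≥ 0`, on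
the finite annulus (a negative interior minimum has `Δf ≥ 0 > (Δ − V)f`-slack); `|x|₂ ≤ √3 ‖x‖∞`.
[folklore: discrete maximum principle (Kuo–Trudinger type); `Δ r^{-p} = p(p−1) r^{-p−2}` in `d = 3`] -/
theorem stub_annulusComparison : ∀ A : ℝ, 0 ≤ A → A < 3 / 4 → ∃ p : ℝ, 1 < p ∧ p < 3 / 2 ∧
    ∃ (r₁ : ℕ) (c₁ : ℝ), 2 ≤ r₁ ∧ 0 < c₁ ∧
      ∀ (u : Literature.Probability.LatticeModels.Site 3 → ℝ) (m M : ℕ) (μ : ℝ), r₁ ≤ m → 4 * m ≤ M → 0 ≤ μ →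
        (∀ x : Literature.Probability.LatticeModels.Site 3,
          Literature.Probability.LatticeModels.Site.supNorm x ≤ M → 0 ≤ u x) →
        (∀ x : Literature.Probability.LatticeModels.Site 3,
          Literature.Probability.LatticeModels.Site.supNorm x = m - 1 → μ ≤ u x) →
        (∀ x : Literature.Probability.LatticeModels.Site 3,
          m ≤ Literature.Probability.LatticeModels.Site.supNorm x →
          Literature.Probability.LatticeModels.Site.supNorm x + 1 ≤ M →
          (∑ i : Fin 3, (u (x + Pi.single i 1) + u (x - Pi.single i 1))) - 6 * u x ≤
            A * u x / (∑ i : Fin 3, ((x i : ℝ)) ^ 2)) →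
        ∀ x : Literature.Probability.LatticeModels.Site 3,
          m ≤ Literature.Probability.LatticeModels.Site.supNorm x →
          4 * Literature.Probability.LatticeModels.Site.supNorm x ≤ M →
          c₁ * μ * ((Literature.Probability.LatticeModels.Site.supNorm x : ℝ) / m) ^ (-p) ≤ u x := by
  sorry

/-- **STUB 3 · `stub_layerMinimum` (provable now, M) — MMS layer minimum from the rows.**  For a row-feasible
level-`L` functional and `1 ≤ m`, `3m ≤ L`: `E{0, 3m e₀} ≤ E{0, y}` whenever `‖y‖∞ = m` (signed-permutation row 2 to
sort `|y_i|`, diagonal MMS row 6 to move the mass of coordinates 1, 2 onto coordinate 0, axis MMS row 5 from `‖y‖₁ ≤ 3m`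
to `3m`).  Row analogue of `criticalTwoPoint_axis_sandwich`. [MessagerMiracleSoleJSP1977, main theorem; DuminilCopin2019 eq. (4.10)] -/
theorem stub_layerMinimum : ∀ (L : ℕ) (cw Cw : ℝ) (E : Finset (Literature.Probability.LatticeModels.Site 3) → ℝ),
    Literature.Probability.LatticeModels.LatticeBootstrapFeasible L cw Cw E →
    ∀ (m : ℕ) (y : Literature.Probability.LatticeModels.Site 3), 1 ≤ m → 3 * m ≤ L →
      Literature.Probability.LatticeModels.Site.supNorm y = m →
      E {0, Pi.single 0 ((3 * m : ℕ) : ℤ)} ≤ E {0, y} := by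
  sorry

/-- **STUB 4 · `stub_oneStepOfAnnulusBound` (provable now, M) — from the annulus power bound to ONE certified scale
factor, uniformly in the level.**  Given `1 < p < 3/2`, `c₁, cw, Cw > 0`, `r ≥ 2`, `k₀ ≥ 1` there are `q ≥ 2`,
`κ > q^{-3/2}`, `k ≥ q` (namely `κ = κ₀ q^{-p}`, `κ₀ = c₁ 3^{-p} min(1, cw (3(r−1))^{-2}/Cw)`, `q ≥ r` with
`q^{3/2−p} > 1/κ₀`, `k = 4 q k₀`) such that for every row-feasible level-`L` functional with `kR ≤ L` whose pair values
obey the annulus bound `c₁ E{0,3(m−1)e₀} (‖x‖∞/m)^{-p} ≤ E{0,x}` (`r ≤ m ≤ ‖x‖∞ ≤ M/4`, `k₀ M ≤ L`), the one-step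
inequality `κ E{0, n e₀} ≤ E{0, q n e₀}` holds for `1 ≤ n ≤ R` (large `n`: `m = n/3 + 1`, `M = 4qn`, axis antitonicity
`feasible_axis_antitone`; small `n < 3(r−1)`: `m = r` and the window rows `cw‖x‖⁻² ≤ E{0,x} ≤ Cw‖x‖⁻¹`). [folklore] -/
theorem stub_oneStepOfAnnulusBound : ∀ (p c₁ cw Cw : ℝ) (r k₀ : ℕ), 1 < p → p < 3 / 2 → 0 < c₁ → 0 < cw → 0 < Cw →
    2 ≤ r → 1 ≤ k₀ → ∃ (q : ℕ) (κ : ℝ) (k : ℕ), 2 ≤ q ∧ (q : ℝ) ^ (-((3 : ℝ) / 2)) < κ ∧ q ≤ k ∧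
      ∀ (L R : ℕ) (E : Finset (Literature.Probability.LatticeModels.Site 3) → ℝ), k * R ≤ L →
        Literature.Probability.LatticeModels.LatticeBootstrapFeasible L cw Cw E →
        (∀ m M : ℕ, r ≤ m → 4 * m ≤ M → k₀ * M ≤ L →
          ∀ x : Literature.Probability.LatticeModels.Site 3,
            m ≤ Literature.Probability.LatticeModels.Site.supNorm x →
            4 * Literature.Probability.LatticeModels.Site.supNorm x ≤ M →
            c₁ * E {0, Pi.single 0 ((3 * (m - 1) : ℕ) : ℤ)} *
                ((Literature.Probability.LatticeModels.Site.supNorm x : ℝ) / m) ^ (-p) ≤ E {0, x}) →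
        ∀ n : ℕ, 1 ≤ n → n ≤ R →
          κ * E {0, Pi.single 0 (n : ℤ)} ≤ E {0, Pi.single 0 ((q * n : ℕ) : ℤ)} := by
  sorry

/-! ## Local facts used by the composition (sorry-free) -/

/-- A pair `{0, y}` with `‖y‖∞ ≤ N` lies in the box `Λ_N`. -/
theorem pair_subset_box {N : ℕ} {y : Site 3} (h : Site.supNorm y ≤ N) :
    ({0, y} : Finset (Site 3)) ⊆ box 3 N := by
  intro z hz
  simp only [Finset.mem_insert, Finset.mem_singleton] at hz
  rcases hz with rfl | rfl
  · exact zero_mem_box 3 N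
  · exact mem_box_iff_supNorm_le.2 h

/-- The axis pair `{0, j e₀}` with `j ≤ N` lies in the box `Λ_N` (cf. `feasible_axis_pos`). -/
theorem axisPair_subset_box {N j : ℕ} (h : j ≤ N) :
    ({0, Pi.single 0 ((j : ℕ) : ℤ)} : Finset (Site 3)) ⊆ box 3 N := by
  intro z hz
  simp only [Finset.mem_insert, Finset.mem_singleton] at hz
  rcases hz with rfl | rfl
  · exact zero_mem_box 3 N
  · rw [mem_box]
    intro i
    by_cases hi : i = 0
    · subst hi; simp only [Pi.single_eq_same]; omega
    · simp only [Pi.single_eq_of_ne hi]; omega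

set_option maxHeartbeats 800000 in
/-- **The annulus bound for a row-feasible functional from a Kato bound at relative depth** (STUBS 2–3 applied to
`u = E{0,·}`; sorry-free glue).  `hcomp` is the conclusion of STUB 2 for the constant `A'` and exponent `p`;
`hKato` a Kato bound with constant `A ≤ A'` on `r₀ ≤ ‖y‖∞`, `k₀‖y‖∞ ≤ L`. -/
theorem annulusBound_of_kato {L r₀ r₁ k₀ : ℕ} {cw Cw A A' p c₁ : ℝ} {E : Finset (Site 3) → ℝ}
    (hfeas : LatticeBootstrapFeasible L cw Cw E) (hk₀ : 1 ≤ k₀) (hr₁ : 2 ≤ r₁) (hAA' : A ≤ A')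
    (hKato : ∀ y : Site 3, r₀ ≤ Site.supNorm y → k₀ * Site.supNorm y ≤ L →
      (∑ i : Fin 3, (E {0, y + Pi.single i 1} + E {0, y - Pi.single i 1})) - 6 * E {0, y} ≤
        A * E {0, y} / (∑ i : Fin 3, ((y i : ℝ)) ^ 2))
    (hcomp : ∀ (u : Site 3 → ℝ) (m M : ℕ) (μ : ℝ), r₁ ≤ m → 4 * m ≤ M → 0 ≤ μ →
        (∀ x : Site 3, Site.supNorm x ≤ M → 0 ≤ u x) →
        (∀ x : Site 3, Site.supNorm x = m - 1 → μ ≤ u x) →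
        (∀ x : Site 3, m ≤ Site.supNorm x → Site.supNorm x + 1 ≤ M →
          (∑ i : Fin 3, (u (x + Pi.single i 1) + u (x - Pi.single i 1))) - 6 * u x ≤
            A' * u x / (∑ i : Fin 3, ((x i : ℝ)) ^ 2)) →
        ∀ x : Site 3, m ≤ Site.supNorm x → 4 * Site.supNorm x ≤ M →
          c₁ * μ * ((Site.supNorm x : ℝ) / m) ^ (-p) ≤ u x) :
    ∀ m M : ℕ, max r₀ r₁ ≤ m → 4 * m ≤ M → k₀ * M ≤ L →
      ∀ x : Site 3, m ≤ Site.supNorm x → 4 * Site.supNorm x ≤ M →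
        c₁ * E {0, Pi.single 0 ((3 * (m - 1) : ℕ) : ℤ)} * ((Site.supNorm x : ℝ) / m) ^ (-p) ≤ E {0, x} := by
  intro m M hrm h4m hkM x hmx h4x
  have hML : M ≤ L := le_trans (Nat.le_mul_of_pos_left M hk₀) hkM
  have hr₁m : r₁ ≤ m := le_trans (le_max_right _ _) hrm
  have hr₀m : r₀ ≤ m := le_trans (le_max_left _ _) hrm
  have hm1 : 1 ≤ m - 1 := by omega
  have h3m : 3 * (m - 1) ≤ L := by omega
  have hμ : 0 ≤ E {0, Pi.single 0 ((3 * (m - 1) : ℕ) : ℤ)} := hfeas.nonneg (axisPair_subset_box h3m)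
  have hpos : ∀ y : Site 3, Site.supNorm y ≤ M → 0 ≤ E {0, y} :=
    fun y hy => hfeas.nonneg (pair_subset_box (le_trans hy hML))
  have hlayer : ∀ y : Site 3, Site.supNorm y = m - 1 → E {0, Pi.single 0 ((3 * (m - 1) : ℕ) : ℤ)} ≤ E {0, y} :=
    fun y hy => stub_layerMinimum L cw Cw E hfeas (m - 1) y hm1 h3m hy
  have hkato' : ∀ y : Site 3, m ≤ Site.supNorm y → Site.supNorm y + 1 ≤ M →
      (∑ i : Fin 3, (E {0, y + Pi.single i 1} + E {0, y - Pi.single i 1})) - 6 * E {0, y} ≤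
        A' * E {0, y} / (∑ i : Fin 3, ((y i : ℝ)) ^ 2) := by
    intro y hmy hyM
    have hk₀y : k₀ * Site.supNorm y ≤ L :=
      le_trans (Nat.mul_le_mul_left k₀ (by omega : Site.supNorm y ≤ M)) hkM
    refine le_trans (hKato y (le_trans hr₀m hmy) hk₀y) ?_
    have hEy : 0 ≤ E {0, y} := hpos y (by omega)
    have hsq : 0 ≤ ∑ i : Fin 3, ((y i : ℝ)) ^ 2 := Finset.sum_nonneg fun i _ => sq_nonneg _
    rw [mul_div_assoc, mul_div_assoc]
    exact mul_le_mul_of_nonneg_right hAA' (div_nonneg hEy hsq)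
  exact hcomp (fun y => E {0, y}) m M (E {0, Pi.single 0 ((3 * (m - 1) : ℕ) : ℤ)}) hr₁m h4m hμ hpos hlayer
    hkato' x hmx h4x

/-! ## The composition (kernel-checked, no sorry of its own): the four stubs give the crux BY NAME -/

set_option maxHeartbeats 800000 in
/-- **`CertifiedWindow` from the stubs.**  STUB 1 gives the Kato constant `A < 3/4` at relative depth `k₀`; STUB 2
(with `A' = max A 0`) the exponent `p < 3/2` and the annulus comparison; STUB 3 the layer minimum feeding the
comparison (`annulusBound_of_kato`); STUB 4 one certified scale factor; the landed `certifiedWindow_of_oneStep`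
(p145628) closes the crux.  The LP-form hypotheses of STUB 1 are discharged for boundary-law functionals by the landed
`boundaryLawFunctional_empty`, `stub_momentPositivity` (p148985) and `stub_heatBathRows` (p149047). -/
theorem CertifiedWindow_of :
    Summit.CriticalPhenomena.Ising3DConformalLimit.Theses.LatticeSDPCertificates.CertifiedWindow := by
  refine Summit.CriticalPhenomena.Ising3DConformalLimit.Theorems.certifiedWindow_of_oneStep ?_
  intro cw Cw hcw hCw
  obtain ⟨A, hA34, r₀, k₀, hr₀, hk₀, hKato⟩ := stub_feasibleKato cw Cw hcw hCw
  have hA'0 : (0 : ℝ) ≤ max A 0 := le_max_right _ _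
  have hA'34 : max A 0 < 3 / 4 := max_lt hA34 (by norm_num)
  obtain ⟨p, hp1, hp32, r₁, c₁, hr₁, hc₁, hcomp⟩ := stub_annulusComparison (max A 0) hA'0 hA'34
  have hr2 : 2 ≤ max r₀ r₁ := le_trans hr₁ (le_max_right _ _)
  obtain ⟨q, κ, k, hq2, hqκ, hqk, hstep⟩ :=
    stub_oneStepOfAnnulusBound p c₁ cw Cw (max r₀ r₁) k₀ hp1 hp32 hc₁ hcw hCw hr2 hk₀
  refine ⟨q, κ, k, hq2, hqκ, hqk, fun R ν hν hfeas n hn hnR => ?_⟩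
  haveI := hν
  have hKatoE := hKato (k * R) (boundaryLawFunctional 3 (k * R) (criticalBeta 3) ν)
    (boundaryLawFunctional_empty (k * R) _ ν)
    (Summit.CriticalPhenomena.Ising3DConformalLimit.Theorems.stub_momentPositivity (k * R) ν hν)
    (Summit.CriticalPhenomena.Ising3DConformalLimit.Theorems.stub_heatBathRows (k * R) ν hν) hfeas
  exact hstep (k * R) R (boundaryLawFunctional 3 (k * R) (criticalBeta 3) ν) le_rfl hfeas
    (annulusBound_of_kato hfeas hk₀ hr₁ (le_max_left A 0) hKatoE hcomp) n hn hnR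

end Summit.CriticalPhenomena.Ising3DConformalLimit.Cruxes.CertifiedWindow.KatoComparison

end
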